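import Mathlib.GroupTheory.Abelianization.Defs
import Literature.NumberTheory.GaloisRepresentations.CyclotomicCharacterArtinNormProofs
import Literature.NumberTheory.GaloisRepresentations.LocalClassFieldTheoryProofs
import Literature.NumberTheory.GaloisRepresentations.LocalGaloisGroupProofs
import Literature.NumberTheory.GaloisRepresentations.AbsGaloisGroupCompact
import HarnessLib

/-!
# Local Kronecker–Weber for continuous characters of an `ℓ`-adic field with `e = f = 1`

`Proofs`-style file (theorems only: no definition, no named fact, no instance).

**What is printed.**  Cassels, *Local Fields* (1986), Ch. 8 §4, Theorem 4.1 ("Kronecker–Weber"):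
*every abelian extension of `ℚ_p` is contained in a cyclotomic one*; equivalently (loc. cit.,
Notes to Ch. 8 §4) `ℚ_p^{ab} = ℚ_p^{un} · ℚ_p^{ram}` with `ℚ_p^{ram} = ℚ_p(μ_{p^∞})`, and under the
Artin map the inertia group of `ℚ_p^{ab}/ℚ_p` is the unit group `ℤ_pˣ`, acting on `μ_{p^∞}` through
`u ↦ [u]` (Serre, *Local class field theory*, Cassels–Fröhlich Ch. VI §3.1 Thm. 2, geometric
normalisation of the tree).  For CHARACTERS this says: a continuous homomorphism `ψ : Γ_{ℚ_p} → A`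
to a Hausdorff abelian group is trivial on `I_{ℚ_p} ∩ ker χ_p` (`χ_p` the `p`-adic cyclotomic
character), and `χ_p(I_{ℚ_p}) = ℤ_pˣ = χ_p(Γ_{ℚ_p})`; consequently `ψ` factors uniquely as
`ψ = μ · ν` with `μ` unramified and `ν` trivial on `ker χ_p`, both continuous.

**What is proved here**, for THE pinned local Artin map `canonicalArtin F` of the tree (all five
clauses are theorems: `isLocalArtinMap_canonicalArtin_holds`) and an arbitrary non-archimedean local
field `F` of characteristic `0` in which `ℓ` is a uniformiser and the residue field has `ℓ` elements
(the intrinsic form of "`F ≅ ℚ_ℓ`" used by `coe_padicIntRingHom_cyclotomicCharacter_toAbsGalois`):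

* `eq_one_of_canonicalArtin_eq_one` (any `F`) — a continuous character of `Γ_F` with values in a
  `T₁` abelian group kills every `w ∈ W_F` with `Art_F(w) = 1` (clause `ker Art_F = closure [W_F, W_F]`
  and continuity of `W_F → Γ_F`);
* `canonicalArtin_eq_one_of_cyclotomicCharacter_eq_one` — for `w ∈ I_F` with `χ_ℓ(w) = 1`,
  `Art_F(w) = 1` (Serre's Theorem 2 on inertia, tree `coe_padicIntRingHom_cyclotomicCharacter_toAbsGalois`);
* `eq_one_of_mem_absInertia_of_cyclotomicCharacter_eq_one` — **local Kronecker–Weber for continuous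
  characters**: `ψ(σ) = 1` for every `σ ∈ I_F ∩ ker χ_ℓ`;
* `exists_mem_weilInertia_cyclotomicCharacter_eq` / `exists_mem_absInertia_cyclotomicCharacter_eq` —
  `χ_ℓ(I_F) = ℤ_ℓˣ` (clause `Art_F(I_F) = 𝒪_Fˣ` and Theorem 2);
* `exists_continuous_character_eq_on_absInertia` — the **inertial part** of `ψ`: a continuous
  character `ν` of `Γ_F` equal to `ψ` on `I_F` and trivial on `ker χ_ℓ` (continuity from compactness:
  `ν⁻¹(C) = χ_ℓ⁻¹(χ_ℓ(I_F ∩ ψ⁻¹ C))`);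
* `exists_unramified_mul_inertial` — the decomposition `ψ = μ · ν`, `μ` unramified, `ν` trivial on
  `ker χ_ℓ`, both continuous.

The open-kernel (finite-order) form of the same theorem for the completions `ℚ_v` of `ℚ`, through the
reciprocity map, is `adicCompletion_rat_exists_eq_comp_cyclotomicCharacter_of_mem_absInertia`
(`LocalKroneckerWeberInertiaProofs.lean`); the present file treats continuous characters with
infinite image (e.g. `ℓ`-adic Galois characters, any `T₁` abelian target) and goes through THE
Artin map instead; the special case of `ℤ_p`-valued characters of `Γ_{ℚ_u}` is
`Literature.NumberTheory.EllipticCurves.apply_eq_one_of_mem_absInertia_of_cyclotomicCharacter_eq_one`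
(`AnticyclotomicInertiaAbovePAnyPrime.lean`, by reduction modulo `p^n` to the open-kernel form).

## References

* J. W. S. Cassels, *Local Fields*, LMS Student Texts 3, CUP 1986, Ch. 8 §4, Thm. 4.1 and the Notes
  to §4 (pp. 151, 155 of the printed book).  [`Cassels1986`]
* J.-P. Serre, *Local class field theory*, Ch. VI of Cassels–Fröhlich, *Algebraic Number Theory*
  (1967), §3.1 Thm. 2.  [`CasselsFrohlichANT1967`]
* J.-P. Serre, *Local Fields*, GTM 67 (1979), Ch. XIII §4 Thm. 1–2; Ch. XIV §7 Thm. 2.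
  [`SerreLocalFields1979`]
-/

noncomputable section

open scoped ValuativeRel
open ValuativeRel

namespace Literature.NumberTheory.GaloisRepresentations

open GaloisRepresentations.IsNonarchimedeanLocalField Field

namespace LocalKroneckerWeber

variable {F : Type} [Field F] [ValuativeRel F] [TopologicalSpace F] [IsNonarchimedeanLocalField F]

/-! ### Characters vanish on the kernel of THE Artin map -/

/-- **A continuous character of `Γ_F` kills `ker Art_F`.**  If `ψ : Γ_F → A` is a continuous
homomorphism to a `T₁` abelian topological group and `w ∈ W_F` has `Art_F(w) = 1`, then
`ψ(w) = 1`: `ker Art_F` is the closure of `[W_F, W_F]` (clause `ker_artin` of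
`isLocalArtinMap_canonicalArtin_holds`), `ψ ∘ (W_F → Γ_F)` is continuous
(`WeilGroup.continuous_toAbsGalois'`) with closed kernel containing the commutator subgroup.
[cite: SerreLocalFields1979, Ch. XIII §4 Thm. 1–2] -/
theorem eq_one_of_canonicalArtin_eq_one {A : Type*} [CommGroup A] [TopologicalSpace A] [T1Space A]
    (ψ : absoluteGaloisGroup F →* A) (hψ : Continuous ψ) {w : WeilGroup F}
    (hw : canonicalArtin F w = 1) : ψ (WeilGroup.toAbsGalois F w) = 1 := by
  have hker : w ∈ ((canonicalArtin F).ker : Set (WeilGroup F)) := by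
    simpa [MonoidHom.mem_ker] using hw
  rw [(isLocalArtinMap_canonicalArtin_holds F).ker_artin] at hker
  have hclosed : IsClosed ((fun x : WeilGroup F => ψ (WeilGroup.toAbsGalois F x)) ⁻¹' {1}) :=
    isClosed_singleton.preimage (hψ.comp WeilGroup.continuous_toAbsGalois')
  have hsub : (commutator (WeilGroup F) : Set (WeilGroup F)) ⊆
      (fun x : WeilGroup F => ψ (WeilGroup.toAbsGalois F x)) ⁻¹' {1} := by
    intro x hx
    have hx' := Abelianization.commutator_subset_ker (ψ.comp (WeilGroup.toAbsGalois F)) hx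
    simpa [MonoidHom.mem_ker] using hx'
  simpa using closure_minimal hsub hclosed hker

/-! ### `ℓ`-adic fields with `e = f = 1` -/

variable {ℓ : ℕ} [Fact ℓ.Prime]
  (hπ : (valuation F).IsUniformizer (((ℓ : ℕ) : 𝒪[F]) : F)) (hq : residueFieldCard F = ℓ)
  (hℓ : valuation F ℓ < 1)

include hπ hq hℓ in
/-- **`Art_F(w) = 1` for `w ∈ I_F ∩ ker χ_ℓ`** (`F` an `ℓ`-adic field with `e = f = 1`): on inertia
`Art_F(w) = ι(χ_ℓ(w))` (Serre's Theorem 2 (2), tree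
`coe_padicIntRingHom_cyclotomicCharacter_toAbsGalois`), so `χ_ℓ(w) = 1` forces `Art_F(w) = 1`.
[cite: CasselsFrohlichANT1967, Ch. VI §3.1 Thm. 2] -/
theorem canonicalArtin_eq_one_of_cyclotomicCharacter_eq_one {w : WeilGroup F}
    (hw : w ∈ WeilGroup.inertia F)
    (hχ : GaloisRep.cyclotomicCharacter F ℓ (WeilGroup.toAbsGalois F w) = 1) :
    canonicalArtin F w = 1 := by
  have h := coe_padicIntRingHom_cyclotomicCharacter_toAbsGalois hπ hq hℓ hw
  rw [hχ, Units.val_one, map_one, OneMemClass.coe_one] at h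
  exact Units.val_eq_one.mp h.symm

include hπ hq hℓ in
/-- **Local Kronecker–Weber for continuous characters, Weil-group form**: a continuous character
`ψ : Γ_F → A` (`A` a `T₁` abelian topological group) of an `ℓ`-adic field with `e = f = 1` is trivial
on every `w ∈ I_F` with `χ_ℓ(w) = 1`.
[cite: Cassels1986, Ch. 8 §4 Thm. 4.1] [cite: CasselsFrohlichANT1967, Ch. VI §3.1 Thm. 2] -/
theorem eq_one_of_mem_inertia_of_cyclotomicCharacter_eq_one {A : Type*} [CommGroup A]
    [TopologicalSpace A] [T1Space A] (ψ : absoluteGaloisGroup F →* A) (hψ : Continuous ψ)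
    {w : WeilGroup F} (hw : w ∈ WeilGroup.inertia F)
    (hχ : GaloisRep.cyclotomicCharacter F ℓ (WeilGroup.toAbsGalois F w) = 1) :
    ψ (WeilGroup.toAbsGalois F w) = 1 :=
  eq_one_of_canonicalArtin_eq_one ψ hψ
    (canonicalArtin_eq_one_of_cyclotomicCharacter_eq_one hπ hq hℓ hw hχ)

include hπ hq hℓ in
/-- **Local Kronecker–Weber for continuous characters**: for an `ℓ`-adic field `F` with `e = f = 1`,
every continuous character `ψ : Γ_F → A` with values in a `T₁` abelian topological group is trivial
on `I_F ∩ ker χ_ℓ` — i.e. `ψ` factors through `Gal(F^{nr} · F(μ_{ℓ^∞}) / F)`.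
[cite: Cassels1986, Ch. 8 §4 Thm. 4.1] [cite: SerreLocalFields1979, Ch. XIV §7 Thm. 2] -/
theorem eq_one_of_mem_absInertia_of_cyclotomicCharacter_eq_one {A : Type*} [CommGroup A]
    [TopologicalSpace A] [T1Space A] (ψ : absoluteGaloisGroup F →* A) (hψ : Continuous ψ)
    {σ : absoluteGaloisGroup F} (hσ : σ ∈ absInertia F)
    (hχ : GaloisRep.cyclotomicCharacter F ℓ σ = 1) : ψ σ = 1 := by
  have hmem : σ ∈ (WeilGroup.inertia F).map (WeilGroup.toAbsGalois F) := by
    rw [WeilGroup.inertia_map_toAbsGalois]; exact hσ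
  obtain ⟨w, hw, rfl⟩ := Subgroup.mem_map.mp hmem
  exact eq_one_of_mem_inertia_of_cyclotomicCharacter_eq_one hπ hq hℓ ψ hψ hw hχ

include hπ hq hℓ in
/-- Two inertia elements with the same cyclotomic character have the same image under every
continuous character (local Kronecker–Weber applied to `τ'⁻¹ τ ∈ I_F ∩ ker χ_ℓ`).
[cite: Cassels1986, Ch. 8 §4 Thm. 4.1] -/
theorem apply_eq_of_mem_absInertia_of_cyclotomicCharacter_eq {A : Type*} [CommGroup A]
    [TopologicalSpace A] [T1Space A] (ψ : absoluteGaloisGroup F →* A) (hψ : Continuous ψ)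
    {τ τ' : absoluteGaloisGroup F} (hτ : τ ∈ absInertia F) (hτ' : τ' ∈ absInertia F)
    (h : GaloisRep.cyclotomicCharacter F ℓ τ = GaloisRep.cyclotomicCharacter F ℓ τ') :
    ψ τ = ψ τ' := by
  have hmem : τ'⁻¹ * τ ∈ absInertia F := mul_mem (inv_mem hτ') hτ
  have hχ : GaloisRep.cyclotomicCharacter F ℓ (τ'⁻¹ * τ) = 1 := by
    rw [map_mul, map_inv, h, inv_mul_cancel]
  have h1 := eq_one_of_mem_absInertia_of_cyclotomicCharacter_eq_one hπ hq hℓ ψ hψ hmem hχ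
  rw [map_mul, map_inv, inv_mul_eq_one] at h1
  exact h1.symm

/-! ### The inertial part of a continuous character

From here on `F` has characteristic `0` (the field embedding `ℚ_ℓ → F`, `LocalField.padicRingHom`,
is used to see that `ι : ℤ_ℓ → 𝒪_F` is injective). -/

variable [CharZero F]

include hπ hq hℓ in
/-- **`χ_ℓ(I_F) = ℤ_ℓˣ`, Weil-group form**: every `ℓ`-adic unit `c` is `χ_ℓ(w)` for some `w` in the
inertia subgroup of `W_F` — the unit `ι(c) ∈ 𝒪_Fˣ` is `Art_F(w)` for an inertial `w` (clause
`image_inertia`), and `ι(χ_ℓ(w)) = Art_F(w) = ι(c)` (Theorem 2 (2)) with `ι : ℤ_ℓ → F` injective.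
[cite: CasselsFrohlichANT1967, Ch. VI §3.1 Thm. 2] [cite: SerreLocalFields1979, Ch. XIII §4 Thm. 1] -/
theorem exists_mem_weilInertia_cyclotomicCharacter_eq (c : ℤ_[ℓ]ˣ) :
    ∃ w ∈ WeilGroup.inertia F,
      GaloisRep.cyclotomicCharacter F ℓ (WeilGroup.toAbsGalois F w) = c := by
  -- the unit `ι(c)` of `F`
  set ι : ℤ_[ℓ] →+* F := (algebraMap 𝒪[F] F).comp (LocalField.padicIntRingHom F ℓ hℓ) with hι
  set u : Fˣ := Units.map (ι : ℤ_[ℓ] →* F) c with hu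
  have hval : valuation F (u : F) = 1 := by
    have h1 : (u : F) = algebraMap 𝒪[F] F (LocalField.padicIntRingHom F ℓ hℓ (c : ℤ_[ℓ])) := by
      simp [hu, hι]
    rw [h1]
    exact (Valuation.integer.integers (valuation F)).one_of_isUnit
      ((c.map (LocalField.padicIntRingHom F ℓ hℓ : ℤ_[ℓ] →* 𝒪[F])).isUnit)
  have hmem : u ∈ (valuation F).valuationSubring.unitGroup := by
    rw [Valuation.mem_unitGroup_iff]; exact hval
  rw [← (isLocalArtinMap_canonicalArtin_holds F).image_inertia, Subgroup.mem_map] at hmem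
  obtain ⟨w, hw, hwu⟩ := hmem
  refine ⟨w, hw, ?_⟩
  -- `ι(χ(w)) = Art w = u = ι(c)` in `F`, hence in `𝒪_F`
  have h := coe_padicIntRingHom_cyclotomicCharacter_toAbsGalois hπ hq hℓ hw
  rw [hwu] at h
  have h1 : (u : F) = ((LocalField.padicIntRingHom F ℓ hℓ (c : ℤ_[ℓ]) : 𝒪[F]) : F) := by
    simp [hu, hι]
    rfl
  have h2 : LocalField.padicIntRingHom F ℓ hℓ
      ((GaloisRep.cyclotomicCharacter F ℓ (WeilGroup.toAbsGalois F w) : ℤ_[ℓ]ˣ) : ℤ_[ℓ]) =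
      LocalField.padicIntRingHom F ℓ hℓ (c : ℤ_[ℓ]) :=
    Subtype.val_injective (h.trans h1)
  -- `ℤ_ℓ → 𝒪_F` is injective: it is the restriction of the field embedding `ℚ_ℓ → F`
  have hinj : Function.Injective (LocalField.padicIntRingHom F ℓ hℓ) := by
    intro a b hab
    have hab' : ((LocalField.padicIntRingHom F ℓ hℓ a : 𝒪[F]) : F) =
        ((LocalField.padicIntRingHom F ℓ hℓ b : 𝒪[F]) : F) := congrArg Subtype.val hab
    rw [← LocalField.padicRingHom_coe, ← LocalField.padicRingHom_coe] at hab'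
    exact PadicInt.ext ((LocalField.padicRingHom F ℓ hℓ).injective hab')
  exact Units.ext (hinj h2)

include hπ hq hℓ in
/-- **`χ_ℓ(I_F) = ℤ_ℓˣ`**: every `ℓ`-adic unit is the cyclotomic character of an element of the
inertia group `I_F ≤ Γ_F` (`F` an `ℓ`-adic field with `e = f = 1`; `F(μ_{ℓ^∞})/F` is totally
ramified with group `ℤ_ℓˣ`).
[cite: Cassels1986, Ch. 8 §4 Thm. 4.1] [cite: SerreLocalFields1979, Ch. IV §4 Prop. 17] -/
theorem exists_mem_absInertia_cyclotomicCharacter_eq (c : ℤ_[ℓ]ˣ) :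
    ∃ σ ∈ absInertia F, GaloisRep.cyclotomicCharacter F ℓ σ = c := by
  obtain ⟨w, hw, hχ⟩ := exists_mem_weilInertia_cyclotomicCharacter_eq hπ hq hℓ c
  exact ⟨WeilGroup.toAbsGalois F w, WeilGroup.mem_inertia_iff.mp hw, hχ⟩

include hπ hq hℓ in
/-- **The inertial part of a continuous character** (`F` an `ℓ`-adic field with `e = f = 1`):
for every continuous character `ψ : Γ_F → A` to a `T₁` abelian topological group there is a
continuous character `ν` of `Γ_F` which agrees with `ψ` on the inertia group and is trivial on
`ker χ_ℓ` — namely `ν(σ) = ψ(τ)` for any `τ ∈ I_F` with `χ_ℓ(τ) = χ_ℓ(σ)` (well defined by local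
Kronecker–Weber, a homomorphism since `I_F` is a subgroup, continuous because
`ν⁻¹(C) = χ_ℓ⁻¹(χ_ℓ(I_F ∩ ψ⁻¹ C))` with `I_F ∩ ψ⁻¹ C` compact for closed `C`).  Equivalently: `ν`
is `ψ|_{I_F}` transported along `χ_ℓ : I_F ↠ ℤ_ℓˣ ≅ Gal(F(μ_{ℓ^∞})/F)`.
[cite: Cassels1986, Ch. 8 §4 Thm. 4.1 and Notes] [cite: SerreLocalFields1979, Ch. XIV §7 Thm. 2] -/
theorem exists_continuous_character_eq_on_absInertia {A : Type*} [CommGroup A]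
    [TopologicalSpace A] [T1Space A] (ψ : absoluteGaloisGroup F →* A) (hψ : Continuous ψ) :
    ∃ ν : absoluteGaloisGroup F →* A, Continuous ν ∧
      (∀ σ ∈ absInertia F, ν σ = ψ σ) ∧
      (∀ σ, GaloisRep.cyclotomicCharacter F ℓ σ = 1 → ν σ = 1) ∧
      (∀ σ τ, τ ∈ absInertia F →
        GaloisRep.cyclotomicCharacter F ℓ τ = GaloisRep.cyclotomicCharacter F ℓ σ → ν σ = ψ τ) := by
  classical
  haveI : CompactSpace (absoluteGaloisGroup F) := absoluteGaloisGroup_compactSpace F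
  set χ := GaloisRep.cyclotomicCharacter F ℓ with hχdef
  -- inertial lifts of the values of `χ`
  have hlift : ∀ σ : absoluteGaloisGroup F, ∃ τ ∈ absInertia F, χ τ = χ σ := fun σ =>
    exists_mem_absInertia_cyclotomicCharacter_eq hπ hq hℓ (χ σ)
  choose τ hτI hτχ using hlift
  -- `ψ (τ σ)` only depends on `χ σ`
  have key : ∀ σ τ', τ' ∈ absInertia F → χ τ' = χ σ → ψ (τ σ) = ψ τ' := fun σ τ' h1 h2 =>
    apply_eq_of_mem_absInertia_of_cyclotomicCharacter_eq hπ hq hℓ ψ hψ (hτI σ) h1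
      ((hτχ σ).trans h2.symm)
  let ν : absoluteGaloisGroup F →* A :=
    { toFun := fun σ => ψ (τ σ)
      map_one' := by rw [key 1 1 (one_mem _) rfl, map_one]
      map_mul' := fun σ σ' => by
        rw [key (σ * σ') (τ σ * τ σ') (mul_mem (hτI σ) (hτI σ'))
          (by rw [map_mul, hτχ, hτχ, map_mul]), map_mul] }
  have hν : ∀ σ, ν σ = ψ (τ σ) := fun σ => rfl
  refine ⟨ν, ?_, fun σ hσ => (hν σ).trans (key σ σ hσ rfl), fun σ hσ => ?_,
    fun σ τ' h1 h2 => (hν σ).trans (key σ τ' h1 h2)⟩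
  · -- continuity
    rw [continuous_iff_isClosed]
    intro C hC
    have hEq : (ν : absoluteGaloisGroup F → A) ⁻¹' C =
        χ ⁻¹' (χ '' ((absInertia F : Set (absoluteGaloisGroup F)) ∩ ψ ⁻¹' C)) := by
      ext σ
      simp only [Set.mem_preimage, Set.mem_image, Set.mem_inter_iff, SetLike.mem_coe]
      constructor
      · intro h
        exact ⟨τ σ, ⟨hτI σ, by rwa [hν] at h⟩, hτχ σ⟩
      · rintro ⟨τ', ⟨hτ'I, hτ'C⟩, hχ'⟩
        rw [hν, key σ τ' hτ'I hχ']
        exact hτ'C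
    rw [hEq]
    refine IsClosed.preimage χ.continuous (IsCompact.isClosed (IsCompact.image ?_ χ.continuous))
    exact ((isClosed_absInertia_holds F).inter (hC.preimage hψ)).isCompact
  · -- trivial on `ker χ`
    rw [hν, key σ 1 (one_mem _) (by rw [map_one, hσ]), map_one]

include hπ hq hℓ in
/-- **Unramified × inertial decomposition** (`F` an `ℓ`-adic field with `e = f = 1`): every
continuous character `ψ : Γ_F → A` to a `T₁` abelian topological group factors as `ψ = μ · ν` with
`μ` continuous and UNRAMIFIED (`μ = 1` on `I_F`) and `ν` continuous and trivial on `ker χ_ℓ`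
(so `ν` factors through `Gal(F(μ_{ℓ^∞})/F) ≅ χ_ℓ(Γ_F)`): Galois form of
`F^{ab} = F^{nr} · F(μ_{ℓ^∞})`.
[cite: Cassels1986, Ch. 8 §4 Thm. 4.1 and Notes] [cite: SerreLocalFields1979, Ch. XIV §7 Thm. 2] -/
theorem exists_unramified_mul_inertial {A : Type*} [CommGroup A] [TopologicalSpace A]
    [IsTopologicalGroup A] [T1Space A] (ψ : absoluteGaloisGroup F →* A) (hψ : Continuous ψ) :
    ∃ μ ν : absoluteGaloisGroup F →* A, (∀ σ, ψ σ = μ σ * ν σ) ∧ Continuous μ ∧ Continuous ν ∧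
      (∀ σ ∈ absInertia F, μ σ = 1) ∧
      (∀ σ, GaloisRep.cyclotomicCharacter F ℓ σ = 1 → ν σ = 1) ∧
      (∀ σ τ, τ ∈ absInertia F →
        GaloisRep.cyclotomicCharacter F ℓ τ = GaloisRep.cyclotomicCharacter F ℓ σ → ν σ = ψ τ) := by
  obtain ⟨ν, hνc, hνI, hνχ, hντ⟩ := exists_continuous_character_eq_on_absInertia hπ hq hℓ ψ hψ
  refine ⟨ψ * ν⁻¹, ν, fun σ => ?_, ?_, hνc, fun σ hσ => ?_, hνχ, hντ⟩
  · simp [MonoidHom.mul_apply, MonoidHom.inv_apply]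
  · have hψν : Continuous fun σ => ψ σ * (ν σ)⁻¹ := hψ.mul hνc.inv
    exact hψν.congr fun σ => by simp [MonoidHom.mul_apply, MonoidHom.inv_apply]
  · simp [MonoidHom.mul_apply, MonoidHom.inv_apply, hνI σ hσ]

end LocalKroneckerWeber

end Literature.NumberTheory.GaloisRepresentations

end
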